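import Summits.ValiantsHypothesis.ValiantsHypothesis.Theorems.LacunarySymmetroidMatrixDescartesCensusPairBudgetKit

/-!
# `MatrixDescartes` census — the PAIR BUDGET of a hypothetical twenty, `#Φ + #G_u ≤ 5` (part 2 of 2)

HONEST FRAMING.  Object-search cell `pub-symmetroid`, door-A item `Theses.LacunarySymmetroid.DoorA26 = PosRootLawAt 2 6 19`
(stmt-ValiantsHypothesis-19979; OPEN, typed, never asserted).  A located NECESSARY CONDITION on a hypothetical twenty (a real symmetric
`2 × 2` six-term pencil `F(x) = ∑ x^{d_l} S_l` with `20` distinct positive det-roots `r_0 < ⋯ < r_19`), valid for EVERY support; nothing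
here bounds `ζ_sym(2,6)`.  Part 1 (`…CensusPairBudgetKit`) has the orthogonal-pair identity `f_u·f_⊥ − g_u² = |u|⁴·det F` and the
DISCRETE SWEEP LEMMA (the real, rank-3 ingredient: at an indefinite point where the mixed form `g_u = u⊥ᵀFu` vanishes, one of
`f_u = uᵀFu`, `f_⊥ = u⊥ᵀFu⊥` is strictly negative and the other strictly positive).

THIS FILE: `pair_budget_of_twenty` — let `Φ` = the trace flips along the roots (`tr F(r_k)·tr F(r_{k+1}) < 0`; `≤ 3` by
`card_traceFlips_le_three_of_twenty`) and, for a direction `u` that is an eigenvector at no root, `G_u` = the NON-flip gaps across which the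
mixed form `g_u` changes sign and on which `det F` is somewhere negative (indefinite gaps where the eigenframe passes the cross `(u,u⊥)`).
Then `#Φ + #G_u ≤ 5`: `f_u` and `f_⊥` are six-nomials (`≤ 5` positive roots each), strictly of the root's type at every root
(`f_u f_⊥ = g_u² > 0` there); a flip gap costs each of them one root; on a `G_u` gap the mixed form vanishes at an interior point (IVT), that
point is indefinite (a twenty has no det-root strictly inside a gap), so by the sweep lemma one of `f_u`, `f_⊥` has the sign opposite to
the gap's type there — two roots for that one (counting lemma of part 1).
What is NOT here: magnitudes.  A root-side sign/counting budget cannot close door A by itself (the pattern «ten distinct kernel directions,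
monotone on `ℝP¹`, one per indefinite gap» satisfies every budget of this file and of the envelope layer); nothing about `DoorA26` on all
supports, the crux `MatrixDescartes` (stmt-ValiantsHypothesis-18050) or `VP ≠ VNP`.

[folklore] Elementary linear algebra of real symmetric `2 × 2` matrices, the intermediate value theorem, and the tree's sparse
Descartes bound for six-nomials; no single source.
-/

-- `Summit.ValiantsHypothesis.ValiantsHypothesis.…` repeats a component by the D-0017 layout
-- (single-conjunct summit), which the `dupNamespace` linter flags; the name is mandated.
set_option linter.dupNamespace false

namespace Summit.ValiantsHypothesis.ValiantsHypothesis.Theorems.LacunarySymmetroidMatrixDescartes.Census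

open Polynomial Finset
open scoped BigOperators Polynomial Matrix
open Summit.ValiantsHypothesis.ValiantsHypothesis.Theorems.SymmetroidDescartes (eval_det_pencil)


/-! ### The pair budget -/

open scoped Classical in
/-- **PAIR BUDGET of a hypothetical twenty** (symmetric letters, ANY support).  Let a real symmetric `2 × 2` six-term pencil have `20`
sorted distinct positive det-roots `r 0 < ⋯ < r 19`, and let `u` be a direction that is an eigenvector of NO `F(r k)` (the mixed form
`u⊥ᵀF(r k)u ≠ 0` for all `k`; all but finitely many directions).  Write `T(x) = tr F(x)` and `g(x) = u⊥ᵀF(x)u`.  Let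
`Φ = {k < 19 : T(r k)·T(r (k+1)) < 0}` (type flips; `≤ 3` by `card_traceFlips_le_three_of_twenty`) and
`G_u = {k < 19 : T(r k)·T(r (k+1)) > 0, g(r k)·g(r (k+1)) < 0, and det F < 0 somewhere on (r k, r (k+1))}`
(non-flip INDEFINITE gaps across which the eigenframe passes the cross `(u,u⊥)`).  Then `#Φ + #G_u ≤ 5`.
Mechanism: `f_u = uᵀFu` and `f_⊥ = u⊥ᵀFu⊥` are six-nomials (`≤ 5` positive roots each), strictly of the root's type at every root
(`f_u f_⊥ = g² > 0` there); a flip gap costs each of them one root; on a `G_u` gap the mixed form vanishes at an interior indefinite point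
where, by the discrete sweep lemma, one of `f_u`, `f_⊥` has the sign opposite to the gap's type — two roots for that one. [folklore] -/
theorem pair_budget_of_twenty (d : Fin 6 → ℕ) (S : Fin 6 → Matrix (Fin 2) (Fin 2) ℝ) (hS : ∀ l, (S l).IsSymm)
    (r : Fin 20 → ℝ) (hr : StrictMono r) (hr0 : ∀ k, 0 < r k)
    (hroot : ∀ k, r k ∈ (Matrix.det (∑ l, ((X : ℝ[X]) ^ d l) • (S l).map C)).roots)
    (u : Fin 2 → ℝ) (hu : ∀ k, ![-u 1, u 0] ⬝ᵥ ((∑ l, r k ^ d l • S l) *ᵥ u) ≠ 0) :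
    (Finset.univ.filter (fun k : Fin 19 =>
        ((∑ l, r k.castSucc ^ d l • S l) 0 0 + (∑ l, r k.castSucc ^ d l • S l) 1 1) *
          ((∑ l, r k.succ ^ d l • S l) 0 0 + (∑ l, r k.succ ^ d l • S l) 1 1) < 0)).card
    + (Finset.univ.filter (fun k : Fin 19 =>
        0 < ((∑ l, r k.castSucc ^ d l • S l) 0 0 + (∑ l, r k.castSucc ^ d l • S l) 1 1) *
          ((∑ l, r k.succ ^ d l • S l) 0 0 + (∑ l, r k.succ ^ d l • S l) 1 1) ∧
        (![-u 1, u 0] ⬝ᵥ ((∑ l, r k.castSucc ^ d l • S l) *ᵥ u)) * (![-u 1, u 0] ⬝ᵥ ((∑ l, r k.succ ^ d l • S l) *ᵥ u)) < 0 ∧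
        ∃ x, r k.castSucc < x ∧ x < r k.succ ∧ (∑ l, x ^ d l • S l).det < 0)).card ≤ 5 := by
  classical
  set p := Matrix.det (∑ l, ((X : ℝ[X]) ^ d l) • (S l).map C) with hp
  -- ## opaque local functions
  obtain ⟨Fm, hFm⟩ : ∃ Fm : ℝ → Matrix (Fin 2) (Fin 2) ℝ, ∀ x, Fm x = ∑ l, x ^ d l • S l := ⟨_, fun _ => rfl⟩
  obtain ⟨T, hT⟩ : ∃ T : ℝ → ℝ, ∀ x, T x = Fm x 0 0 + Fm x 1 1 := ⟨_, fun _ => rfl⟩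
  obtain ⟨fu, hfu⟩ : ∃ fu : ℝ → ℝ, ∀ x, fu x = u ⬝ᵥ (Fm x *ᵥ u) := ⟨_, fun _ => rfl⟩
  obtain ⟨fp, hfp⟩ : ∃ fp : ℝ → ℝ, ∀ x, fp x = ![-u 1, u 0] ⬝ᵥ (Fm x *ᵥ ![-u 1, u 0]) := ⟨_, fun _ => rfl⟩
  obtain ⟨g, hg⟩ : ∃ g : ℝ → ℝ, ∀ x, g x = ![-u 1, u 0] ⬝ᵥ (Fm x *ᵥ u) := ⟨_, fun _ => rfl⟩
  obtain ⟨Φ, hΦ⟩ : ∃ Φ : Finset (Fin 19), Φ = Finset.univ.filter (fun k : Fin 19 =>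
        ((∑ l, r k.castSucc ^ d l • S l) 0 0 + (∑ l, r k.castSucc ^ d l • S l) 1 1) *
          ((∑ l, r k.succ ^ d l • S l) 0 0 + (∑ l, r k.succ ^ d l • S l) 1 1) < 0) := ⟨_, rfl⟩
  obtain ⟨G, hG⟩ : ∃ G : Finset (Fin 19), G = Finset.univ.filter (fun k : Fin 19 =>
        0 < ((∑ l, r k.castSucc ^ d l • S l) 0 0 + (∑ l, r k.castSucc ^ d l • S l) 1 1) *
          ((∑ l, r k.succ ^ d l • S l) 0 0 + (∑ l, r k.succ ^ d l • S l) 1 1) ∧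
        (![-u 1, u 0] ⬝ᵥ ((∑ l, r k.castSucc ^ d l • S l) *ᵥ u)) * (![-u 1, u 0] ⬝ᵥ ((∑ l, r k.succ ^ d l • S l) *ᵥ u)) < 0 ∧
        ∃ x, r k.castSucc < x ∧ x < r k.succ ∧ (∑ l, x ^ d l • S l).det < 0) := ⟨_, rfl⟩
  rw [← hΦ, ← hG]
  have hΦmem : ∀ k : Fin 19, k ∈ Φ ↔ T (r k.castSucc) * T (r k.succ) < 0 := by
    intro k; rw [hΦ, Finset.mem_filter, hT, hT, hFm, hFm]; simp only [Finset.mem_univ, true_and]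
  have hGmem : ∀ k : Fin 19, k ∈ G ↔ 0 < T (r k.castSucc) * T (r k.succ) ∧ g (r k.castSucc) * g (r k.succ) < 0 ∧
      ∃ x, r k.castSucc < x ∧ x < r k.succ ∧ (Fm x).det < 0 := by
    intro k
    simp only [hG, Finset.mem_filter, Finset.mem_univ, true_and, hT, hg, hFm]
  -- ## generic facts
  have hFsym : ∀ x, (Fm x).IsSymm := by
    intro x
    rw [hFm]
    unfold Matrix.IsSymm
    rw [Matrix.transpose_sum]
    exact Finset.sum_congr rfl fun l _ => by rw [Matrix.transpose_smul, (hS l).eq]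
  have hpev : ∀ x, p.eval x = (Fm x).det := fun x => by rw [hp, eval_det_pencil S d x, hFm]
  have hp0 : p ≠ 0 := (mem_roots'.mp (hroot 0)).1
  have hisroot : ∀ k, p.IsRoot (r k) := fun k => (mem_roots'.mp (hroot k)).2
  have hdet0 : ∀ k, (Fm (r k)).det = 0 := fun k => by rw [← hpev]; exact hisroot k
  -- the twenty: exactly twenty positive roots
  have hsub : Finset.univ.image r ⊆ p.roots.toFinset.filter (fun t => 0 < t) := by
    intro x hx
    obtain ⟨k, _, rfl⟩ := Finset.mem_image.mp hx
    rw [Finset.mem_filter, Multiset.mem_toFinset]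
    exact ⟨hroot k, hr0 k⟩
  have hcardim : (Finset.univ.image r).card = 20 := by
    rw [Finset.card_image_of_injective _ hr.injective]; simp
  have h20 : 20 ≤ (p.roots.toFinset.filter (fun t => 0 < t)).card := by
    rw [← hcardim]; exact Finset.card_le_card hsub
  have hcard20 : (p.roots.toFinset.filter (fun t => 0 < t)).card = 20 := card_posRoots_eq_twenty_of_le d S h20
  -- no positive det-root strictly inside a gap
  have hnoroot : ∀ k : Fin 19, ∀ x, r k.castSucc < x → x < r k.succ → p.eval x ≠ 0 := by
    intro k x hx1 hx2 hx0
    have hxpos : 0 < x := lt_trans (hr0 _) hx1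
    have hxmem : x ∈ p.roots.toFinset.filter (fun t => 0 < t) := by
      rw [Finset.mem_filter, Multiset.mem_toFinset, mem_roots']
      exact ⟨⟨hp0, hx0⟩, hxpos⟩
    have hxnot : x ∉ Finset.univ.image r := by
      intro hx
      obtain ⟨j, _, hj⟩ := Finset.mem_image.mp hx
      rw [← hj] at hx1 hx2
      have h1 : k.castSucc < j := hr.lt_iff_lt.mp hx1
      have h2 : j < k.succ := hr.lt_iff_lt.mp hx2
      rw [Fin.lt_def, Fin.val_castSucc] at h1
      rw [Fin.lt_def, Fin.val_succ] at h2
      omega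
    have hle : (insert x (Finset.univ.image r)).card ≤ (p.roots.toFinset.filter (fun t => 0 < t)).card :=
      Finset.card_le_card (Finset.insert_subset hxmem hsub)
    rw [Finset.card_insert_of_notMem hxnot, hcardim, hcard20] at hle
    omega
  -- ## at the roots: types and the orthogonal pair
  have hTne : ∀ k, T (r k) ≠ 0 := by
    intro k; rw [hT, hFm]
    exact trace_pencil_eval_ne_zero_of_twenty d S hS h20 (hr0 k) (hisroot k)
  have hune : u ≠ 0 := by
    intro h; apply hu 0; rw [h]; simp
  have hpne : ![-u 1, u 0] ≠ 0 := by
    intro h; apply hune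
    have h0 := congrFun h 0; have h1 := congrFun h 1
    simp only [Matrix.cons_val_zero, Matrix.cons_val_one, Pi.zero_apply, neg_eq_zero] at h0 h1
    funext i; fin_cases i
    · exact h1
    · exact h0
  have hprod : ∀ k, fu (r k) * fp (r k) = g (r k) ^ 2 := by
    intro k; rw [hfu, hfp, hg]
    exact quadForm_mul_perp_eq_mixed_sq_of_det_eq_zero _ (hFsym _) (hdet0 k) u
  have hgr : ∀ k, g (r k) ≠ 0 := fun k => by rw [hg, hFm]; exact hu k
  have hfune : ∀ k, fu (r k) ≠ 0 := by
    intro k h; have := hprod k; rw [h, zero_mul] at this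
    exact pow_ne_zero 2 (hgr k) this.symm
  have hfpne : ∀ k, fp (r k) ≠ 0 := by
    intro k h; have := hprod k; rw [h, mul_zero] at this
    exact pow_ne_zero 2 (hgr k) this.symm
  have hTf : ∀ k, 0 < T (r k) * fu (r k) := by
    intro k
    have h0 : 0 ≤ T (r k) * fu (r k) := by
      rw [hT, hfu]; exact trace_mul_quadForm_nonneg_of_det_eq_zero _ (hFsym _) (hdet0 k) u
    exact lt_of_le_of_ne h0 (Ne.symm (mul_ne_zero (hTne k) (hfune k)))
  have hTp : ∀ k, 0 < T (r k) * fp (r k) := by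
    intro k
    have h0 : 0 ≤ T (r k) * fp (r k) := by
      rw [hT, hfp]; exact trace_mul_quadForm_nonneg_of_det_eq_zero _ (hFsym _) (hdet0 k) (![-u 1, u 0])
    exact lt_of_le_of_ne h0 (Ne.symm (mul_ne_zero (hTne k) (hfpne k)))
  -- ## the polynomials behind `fu`, `fp`, `g`
  obtain ⟨φu, hφu⟩ : ∃ φ : ℝ[X], φ = Matrix.det (∑ l, ((X : ℝ[X]) ^ d l) • (!![u ⬝ᵥ (S l *ᵥ u)] : Matrix (Fin 1) (Fin 1) ℝ).map C) :=
    ⟨_, rfl⟩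
  obtain ⟨φp, hφp⟩ : ∃ φ : ℝ[X],
      φ = Matrix.det (∑ l, ((X : ℝ[X]) ^ d l) • (!![![-u 1, u 0] ⬝ᵥ (S l *ᵥ ![-u 1, u 0])] : Matrix (Fin 1) (Fin 1) ℝ).map C) := ⟨_, rfl⟩
  obtain ⟨ψ, hψ⟩ : ∃ φ : ℝ[X], φ = Matrix.det (∑ l, ((X : ℝ[X]) ^ d l) • (!![![-u 1, u 0] ⬝ᵥ (S l *ᵥ u)] : Matrix (Fin 1) (Fin 1) ℝ).map C) :=
    ⟨_, rfl⟩
  have hφuev : ∀ x, φu.eval x = fu x := fun x => by rw [hφu, eval_bilinForm_pencil_one, hfu, hFm]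
  have hφpev : ∀ x, φp.eval x = fp x := fun x => by rw [hφp, eval_bilinForm_pencil_one, hfp, hFm]
  have hψev : ∀ x, ψ.eval x = g x := fun x => by rw [hψ, eval_bilinForm_pencil_one, hg, hFm]
  have hφu5 : (φu.roots.toFinset.filter (fun t => 0 < t)).card ≤ 5 := by
    have hne : Matrix.det (∑ l, ((X : ℝ[X]) ^ d l) • (!![u ⬝ᵥ (S l *ᵥ u)] : Matrix (Fin 1) (Fin 1) ℝ).map C) ≠ 0 := by
      intro h0; apply hfune 0; rw [← hφuev, hφu, h0, eval_zero]
    have h := card_posRoots_nomial_lt d (fun l => u ⬝ᵥ (S l *ᵥ u)) hne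
    rw [← hφu] at h; omega
  have hφp5 : (φp.roots.toFinset.filter (fun t => 0 < t)).card ≤ 5 := by
    have hne : Matrix.det (∑ l, ((X : ℝ[X]) ^ d l) • (!![![-u 1, u 0] ⬝ᵥ (S l *ᵥ ![-u 1, u 0])] : Matrix (Fin 1) (Fin 1) ℝ).map C) ≠ 0 := by
      intro h0; apply hfpne 0; rw [← hφpev, hφp, h0, eval_zero]
    have h := card_posRoots_nomial_lt d (fun l => ![-u 1, u 0] ⬝ᵥ (S l *ᵥ ![-u 1, u 0])) hne
    rw [← hφp] at h; omega
  -- ## on a `G` gap: an interior indefinite point where the mixed form vanishes (IVT), and the sweep lemma there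
  have hGpt : ∀ k ∈ G, ∃ x₀, r k.castSucc < x₀ ∧ x₀ < r k.succ ∧ g x₀ = 0 ∧ fu x₀ * fp x₀ < 0 := by
    intro k hk
    obtain ⟨_, hgg, x₁, hx₁l, hx₁r, hx₁det⟩ := (hGmem k).mp hk
    -- IVT for the mixed form
    have hcont : ContinuousOn (fun x => ψ.eval x) (Set.Icc (r k.castSucc) (r k.succ)) :=
      (Polynomial.continuous ψ).continuousOn
    have hab : r k.castSucc ≤ r k.succ := (hr (show k.castSucc < k.succ from Fin.castSucc_lt_succ)).le
    obtain ⟨x₀, hx₀mem, hx₀⟩ : ∃ x₀ ∈ Set.Ioo (r k.castSucc) (r k.succ), ψ.eval x₀ = 0 := by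
      rcases lt_or_gt_of_ne (hgr k.castSucc) with hneg | hpos
      · have hpos' : 0 < g (r k.succ) := by
          by_contra hle; rw [not_lt] at hle
          have := mul_nonneg_of_nonpos_of_nonpos hneg.le hle
          linarith
        have hmem : (0 : ℝ) ∈ Set.Ioo (ψ.eval (r k.castSucc)) (ψ.eval (r k.succ)) := by
          rw [hψev, hψev]; exact ⟨hneg, hpos'⟩
        exact intermediate_value_Ioo hab hcont hmem
      · have hneg' : g (r k.succ) < 0 := sgn_neg_of_mul_neg_of_pos hgg hpos
        have hmem : (0 : ℝ) ∈ Set.Ioo (ψ.eval (r k.succ)) (ψ.eval (r k.castSucc)) := by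
          rw [hψev, hψev]; exact ⟨hneg', hpos⟩
        exact intermediate_value_Ioo' hab hcont hmem
    rw [hψev] at hx₀
    refine ⟨x₀, hx₀mem.1, hx₀mem.2, hx₀, ?_⟩
    -- the point `x₀` is indefinite: no det-root inside the gap, and `x₁` is indefinite
    have hx₀det : (Fm x₀).det < 0 := by
      have hne0 : (Fm x₀).det ≠ 0 := by rw [← hpev]; exact hnoroot k x₀ hx₀mem.1 hx₀mem.2
      rcases lt_or_gt_of_ne hne0 with h | h
      · exact h
      · exfalso
        -- `det F` changes sign between `x₀` and `x₁`, both inside the gap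
        have hcontp : Continuous (fun x => p.eval x) := Polynomial.continuous p
        rcases lt_trichotomy x₀ x₁ with hlt | heq | hgt
        · have hmem : (0 : ℝ) ∈ Set.Ioo (p.eval x₁) (p.eval x₀) := by rw [hpev, hpev]; exact ⟨hx₁det, h⟩
          obtain ⟨y, hy, hy0⟩ := intermediate_value_Ioo' hlt.le hcontp.continuousOn hmem
          exact hnoroot k y (lt_trans hx₀mem.1 hy.1) (lt_trans hy.2 hx₁r) hy0
        · rw [heq] at h; exact absurd hx₁det (not_lt.mpr h.le)
        · have hmem : (0 : ℝ) ∈ Set.Ioo (p.eval x₁) (p.eval x₀) := by rw [hpev, hpev]; exact ⟨hx₁det, h⟩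
          obtain ⟨y, hy, hy0⟩ := intermediate_value_Ioo hgt.le hcontp.continuousOn hmem
          exact hnoroot k y (lt_trans hx₁l hy.1) (lt_trans hy.2 hx₀mem.2) hy0
    rw [hfu, hfp]
    refine quadForm_mul_perp_neg_of_mixed_eq_zero _ (hFsym _) hx₀det u hune ?_
    rw [← hg]; exact hx₀
  choose! x₀ hx₀l hx₀r hx₀g hx₀sweep using hGpt
  -- ## split `G` according to which of `fu`, `fp` has the wrong sign at `x₀`
  obtain ⟨G₁, hG₁⟩ : ∃ G₁ : Finset (Fin 19), G₁ = G.filter (fun k => T (r k.castSucc) * fu (x₀ k) < 0) := ⟨_, rfl⟩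
  obtain ⟨G₂, hG₂⟩ : ∃ G₂ : Finset (Fin 19), G₂ = G.filter (fun k => T (r k.castSucc) * fp (x₀ k) < 0) := ⟨_, rfl⟩
  have hGsub : G ⊆ G₁ ∪ G₂ := by
    intro k hk
    rw [Finset.mem_union, hG₁, hG₂, Finset.mem_filter, Finset.mem_filter]
    by_contra hcon
    simp only [not_or, not_and, not_lt] at hcon
    have h1 := hcon.1 hk
    have h2 := hcon.2 hk
    have hsw := hx₀sweep k hk
    have hT2 : 0 < T (r k.castSucc) * T (r k.castSucc) := mul_self_pos.mpr (hTne k.castSucc)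
    -- `(T fu(x₀)) (T fp(x₀)) = T² (fu fp)(x₀) < 0`, contradicting `h1, h2 ≥ 0`
    have h3 : 0 ≤ (T (r k.castSucc) * fu (x₀ k)) * (T (r k.castSucc) * fp (x₀ k)) := mul_nonneg h1 h2
    have h4 : (T (r k.castSucc) * T (r k.castSucc)) * (fu (x₀ k) * fp (x₀ k)) < 0 := mul_neg_of_pos_of_neg hT2 hsw
    have h5 : (T (r k.castSucc) * fu (x₀ k)) * (T (r k.castSucc) * fp (x₀ k))
        = (T (r k.castSucc) * T (r k.castSucc)) * (fu (x₀ k) * fp (x₀ k)) := by ring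
    rw [h5] at h3
    exact absurd h4 (not_lt.mpr h3)
  -- ## the two counting instances
  have hΦG : ∀ k, k ∈ Φ → k ∈ G → False := by
    intro k hkΦ hkG
    have h1 := (hΦmem k).mp hkΦ
    have h2 := ((hGmem k).mp hkG).1
    linarith
  have hdisj1 : Disjoint Φ G₁ := by
    rw [Finset.disjoint_left]; intro k hk hk1
    rw [hG₁, Finset.mem_filter] at hk1
    exact hΦG k hk hk1.1
  have hdisj2 : Disjoint Φ G₂ := by
    rw [Finset.disjoint_left]; intro k hk hk2
    rw [hG₂, Finset.mem_filter] at hk2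
    exact hΦG k hk hk2.1
  -- flips: both forms change sign
  have hflip_u : ∀ k ∈ Φ, φu.eval (r k.castSucc) * φu.eval (r k.succ) < 0 := by
    intro k hk
    rw [hφuev, hφuev]
    have h := (hΦmem k).mp hk
    have a := hTf k.castSucc
    have b := hTf k.succ
    -- (T fu)(T' fu') > 0 and T T' < 0 ⇒ fu fu' < 0
    have hab : 0 < (T (r k.castSucc) * T (r k.succ)) * (fu (r k.castSucc) * fu (r k.succ)) := by
      have := mul_pos a b; linarith [this]
    exact neg_of_mul_pos_of_neg' hab h
  have hflip_p : ∀ k ∈ Φ, φp.eval (r k.castSucc) * φp.eval (r k.succ) < 0 := by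
    intro k hk
    rw [hφpev, hφpev]
    have h := (hΦmem k).mp hk
    have a := hTp k.castSucc
    have b := hTp k.succ
    have hab : 0 < (T (r k.castSucc) * T (r k.succ)) * (fp (r k.castSucc) * fp (r k.succ)) := by
      have := mul_pos a b; linarith [this]
    exact neg_of_mul_pos_of_neg' hab h
  -- dips
  have hB0_1 : ∀ k ∈ G₁, r k.castSucc < x₀ k ∧ x₀ k < r k.succ := by
    intro k hk; rw [hG₁, Finset.mem_filter] at hk; exact ⟨hx₀l k hk.1, hx₀r k hk.1⟩
  have hB0_2 : ∀ k ∈ G₂, r k.castSucc < x₀ k ∧ x₀ k < r k.succ := by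
    intro k hk; rw [hG₂, Finset.mem_filter] at hk; exact ⟨hx₀l k hk.1, hx₀r k hk.1⟩
  have hB1_1 : ∀ k ∈ G₁, φu.eval (r k.castSucc) * φu.eval (x₀ k) < 0 := by
    intro k hk
    rw [hG₁, Finset.mem_filter] at hk
    rw [hφuev, hφuev]
    have a := hTf k.castSucc
    have b := hk.2
    -- (T fu(r)) (T fu(x₀)) < 0 ⇒ T² (fu(r) fu(x₀)) < 0 ⇒ fu(r) fu(x₀) < 0
    have hab : (T (r k.castSucc) * T (r k.castSucc)) * (fu (r k.castSucc) * fu (x₀ k)) < 0 := by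
      have := mul_neg_of_pos_of_neg a b; linarith [this]
    have hTT : 0 < T (r k.castSucc) * T (r k.castSucc) := mul_self_pos.mpr (hTne k.castSucc)
    exact sgn_neg_of_mul_neg_of_pos hab hTT
  have hB1_2 : ∀ k ∈ G₂, φp.eval (r k.castSucc) * φp.eval (x₀ k) < 0 := by
    intro k hk
    rw [hG₂, Finset.mem_filter] at hk
    rw [hφpev, hφpev]
    have a := hTp k.castSucc
    have b := hk.2
    have hab : (T (r k.castSucc) * T (r k.castSucc)) * (fp (r k.castSucc) * fp (x₀ k)) < 0 := by
      have := mul_neg_of_pos_of_neg a b; linarith [this]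
    have hTT : 0 < T (r k.castSucc) * T (r k.castSucc) := mul_self_pos.mpr (hTne k.castSucc)
    exact sgn_neg_of_mul_neg_of_pos hab hTT
  have hB2_1 : ∀ k ∈ G₁, φu.eval (x₀ k) * φu.eval (r k.succ) < 0 := by
    intro k hk
    rw [hG₁, Finset.mem_filter] at hk
    rw [hφuev, hφuev]
    have hTT := ((hGmem k).mp hk.1).1          -- T T' > 0
    have a := hTf k.succ                        -- T' fu' > 0
    have b := hk.2                              -- T fu(x₀) < 0
    -- (T fu(x₀)) (T T') (T' fu') < 0 ⇒ (T T')·T'... : multiply: (T fu x₀)(T' fu') < 0 and (T T') > 0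
    have h1 : (T (r k.castSucc) * fu (x₀ k)) * (T (r k.succ) * fu (r k.succ)) < 0 := mul_neg_of_neg_of_pos b a
    have h2 : (T (r k.castSucc) * T (r k.succ)) * (fu (x₀ k) * fu (r k.succ)) < 0 := by linarith [h1]
    exact sgn_neg_of_mul_neg_of_pos h2 hTT
  have hB2_2 : ∀ k ∈ G₂, φp.eval (x₀ k) * φp.eval (r k.succ) < 0 := by
    intro k hk
    rw [hG₂, Finset.mem_filter] at hk
    rw [hφpev, hφpev]
    have hTT := ((hGmem k).mp hk.1).1
    have a := hTp k.succ
    have b := hk.2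
    have h1 : (T (r k.castSucc) * fp (x₀ k)) * (T (r k.succ) * fp (r k.succ)) < 0 := mul_neg_of_neg_of_pos b a
    have h2 : (T (r k.castSucc) * T (r k.succ)) * (fp (x₀ k) * fp (r k.succ)) < 0 := by linarith [h1]
    exact sgn_neg_of_mul_neg_of_pos h2 hTT
  have c1 := card_add_two_mul_card_le_card_posRoots φu r hr hr0 x₀ Φ G₁ hdisj1 hflip_u hB0_1 hB1_1 hB2_1
  have c2 := card_add_two_mul_card_le_card_posRoots φp r hr hr0 x₀ Φ G₂ hdisj2 hflip_p hB0_2 hB1_2 hB2_2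
  have c3 : G.card ≤ G₁.card + G₂.card := (Finset.card_le_card hGsub).trans (Finset.card_union_le _ _)
  omega

end Summit.ValiantsHypothesis.ValiantsHypothesis.Theorems.LacunarySymmetroidMatrixDescartes.Census
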